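import Summits.ResolutionOfSingularities.ResolutionOfSingularities.Theorems.LossPolygon4
import Summits.ResolutionOfSingularities.ResolutionOfSingularities.Theorems.LossPolygon3
import Summits.ResolutionOfSingularities.ResolutionOfSingularities.Theorems.LossEpisode
import HarnessLib

/-!
# LossShear — the vertex of the residual polygon is INVARIANT under the shear of the free letter into a HEAVY wall
(CJS's vertex preparation, exact and characteristic-free for the walk), and the law `β_{t+1} ≤ β_t` at a kept exit X1
translated along the free letter

decomp-res-lens-3, gen 28 (NODE-g28 rev 2 §6.3 F13 (i)/(iv), §6.4 law (L_X1)).  TOOLS at 0 (critic letter row 220i).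
[CJS2020] = Cossart–Jannsen–Saito, arXiv:0905.2191 = LNM 2270: Lemma 7.x «vertex preparation» / proof of Lemma 13.3 (Lemma 232):
a coordinate change `u_c ↦ u_c + g·u_a` moves every point of `Δ(f; u_a, u_b; u_c)` toward the solvable point `(1, 0)`, so when
`α < 1` the vertex `v = (α, β)` and its initial form are untouched.  Here for the tree's finite generating set `polyPts` and the
tree's `shear c a g : X_c ↦ X_c + g·X_a` (`LossPolygon4`), followed by the cleaning `deletePthPowers q` (which only deletes
monomials and never the vertex monomial, an original monomial of the clean equation).

* §1 `shearExp`, `shear_monomial`, `coeff_shear` — the monomial expansion of the shear (binomial theorem);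
  `exists_shearExp_eq_of_mem_support_shear` (every monomial of `σF` is `u_a^{A+n} u_b^B u_c^{C−n}` for a monomial
  `u_a^A u_b^B u_c^C` of `F`), `coeff_shear_eq_coeff` (an exponent not reachable from another monomial keeps its coefficient).
* §2 `vertexOf_polyPts_shear`, `vertexOf_polyPts_deletePthPowers_shear` — THE V-LEMMA: under `α < 1` (heavy wall `a`),
  `r c = 0`, `r a ≤ D a` on the support (walls divide) [and `F` clean for the cleaned version] the vertex is unchanged.
* §3 `betaOf_polyPts_succ_chart_fst_translated_le` — walk level: at a move in the chart of the heavy wall `a` translated only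
  along the free letter `c` (a kept exit of type X1, or untranslated), `β_{t+1} = γ⁻(Δ*) ≤ β(Δ*) = β_t`
  (`polyPts_succ_chart_fst_translated` + `betaOf_image_psi10` + `gammaMinusOf_le_betaOf` + the V-lemma).
* (§4, the run-state level laws (L_R) `runBeta_R_lt` / (L_X1) `runBeta_X1_le`, lives in the sequel `Theorems.LossShearRun`.)
-/

open MvPolynomial Finset
open Literature.AlgebraicGeometry.Resolution
open Literature.AlgebraicGeometry.Resolution.Hauser2010
open Literature.AlgebraicGeometry.Resolution.PointBlowup
open Summit.ResolutionOfSingularities.ResolutionOfSingularities.Theorems.TightDefectClasses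
open Summit.ResolutionOfSingularities.ResolutionOfSingularities.Theorems.TightDefectStrongWalks
open Summit.ResolutionOfSingularities.ResolutionOfSingularities.Theorems.ItineraryCutClasses
open Summit.ResolutionOfSingularities.ResolutionOfSingularities.Theorems.BoundaryLedger
open Summit.ResolutionOfSingularities.ResolutionOfSingularities.Theorems.ProximityCut
open Summit.ResolutionOfSingularities.ResolutionOfSingularities.Theorems.LossExitCone

namespace Summit.ResolutionOfSingularities.ResolutionOfSingularities.Theorems.LossPolygon

variable {K : Type} [Field K] [DecidableEq K]
variable {q : ℕ} {s₀ : State (Fin 3) K}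

section ShearVertex

variable {a b c : Fin 3}

/-! ## §1 The monomial expansion of the shear -/

/-- The exponent `u_a^{D a + n} u_b^{D b} u_c^{D c − n}`: `n` letters `c` of `u^D` converted into letters `a`. [new] -/
noncomputable def shearExp (a b c : Fin 3) (D : Fin 3 →₀ ℕ) (n : ℕ) : Fin 3 →₀ ℕ :=
  Finsupp.single a (D a + n) + Finsupp.single b (D b) + Finsupp.single c (D c - n)

/-- `shearExp_apply_fst`: the `a`-exponent of `shearExp`. [new; elementary] -/
theorem shearExp_apply_fst (hab : a ≠ b) (hac : a ≠ c) (D : Fin 3 →₀ ℕ) (n : ℕ) : shearExp a b c D n a = D a + n := by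
  simp [shearExp, hab.symm, hac.symm]

/-- `shearExp_apply_snd`: the `b`-exponent of `shearExp`. [new; elementary] -/
theorem shearExp_apply_snd (hab : a ≠ b) (hbc : b ≠ c) (D : Fin 3 →₀ ℕ) (n : ℕ) : shearExp a b c D n b = D b := by
  simp [shearExp, hab, hbc.symm]

/-- `shearExp_apply_thd`: the `c`-exponent of `shearExp`. [new; elementary] -/
theorem shearExp_apply_thd (hac : a ≠ c) (hbc : b ≠ c) (D : Fin 3 →₀ ℕ) (n : ℕ) : shearExp a b c D n c = D c - n := by
  simp [shearExp, hac, hbc]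

/-- `shearExp_zero`: converting no letter gives back the exponent. [new; elementary] -/
theorem shearExp_zero (hab : a ≠ b) (hac : a ≠ c) (hbc : b ≠ c) (D : Fin 3 →₀ ℕ) : shearExp a b c D 0 = D := by
  unfold shearExp
  rw [add_zero, Nat.sub_zero]
  exact (finsupp_fin3_eq hab hac hbc D).symm

/-- `shearExp` is injective in `n` up to `D`: `shearExp D n = D` forces `n = 0`. [new; elementary] -/
theorem shearExp_eq_self_iff (hab : a ≠ b) (hac : a ≠ c) (hbc : b ≠ c) (D : Fin 3 →₀ ℕ) (n : ℕ) :
    shearExp a b c D n = D ↔ n = 0 := by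
  constructor
  · intro h
    have h1 : shearExp a b c D n a = D a := by rw [h]
    rw [shearExp_apply_fst hab hac] at h1
    omega
  · rintro rfl; exact shearExp_zero hab hac hbc D

omit [DecidableEq K] in
/-- A monomial as `C r · X_a^{D a} X_b^{D b} · X_c^{D c}`. [folklore] -/
theorem monomial_eq_C_mul_X_pow (hab : a ≠ b) (hac : a ≠ c) (hbc : b ≠ c) (D : Fin 3 →₀ ℕ) (r : K) :
    monomial D r = C r * X a ^ (D a) * X b ^ (D b) * X c ^ (D c) := by
  conv_lhs => rw [finsupp_fin3_eq hab hac hbc D]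
  rw [X_pow_eq_monomial, X_pow_eq_monomial, X_pow_eq_monomial, C_mul_monomial, monomial_mul, monomial_mul, mul_one,
    mul_one, mul_one]

omit [DecidableEq K] in
/-- **THE SHEAR OF A MONOMIAL (PROVED; binomial theorem):**
`σ_{c,a,g}(r·u^D) = Σ_{n ≤ D c} (D c choose n)·g^n·r · u_a^{D a + n} u_b^{D b} u_c^{D c − n}`. [folklore; CJS2020 proof of Lemma 13.3] -/
theorem shear_monomial (hab : a ≠ b) (hac : a ≠ c) (hbc : b ≠ c) (g : K) (D : Fin 3 →₀ ℕ) (r : K) :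
    shear c a g (monomial D r) =
      ∑ n ∈ Finset.range (D c + 1), monomial (shearExp a b c D n) (r * g ^ n * ((D c).choose n : K)) := by
  rw [monomial_eq_C_mul_X_pow hab hac hbc D r, map_mul, map_mul, map_mul, map_pow, map_pow, map_pow, shear_X, shear_X,
    shear_X, if_neg hac, if_neg hbc, if_pos rfl, algHom_C, algebraMap_eq, add_comm (X c) _, add_pow,
    Finset.mul_sum]
  refine Finset.sum_congr rfl fun n hn => ?_
  rw [mul_pow, ← map_pow, ← map_natCast (C : K →+* MvPolynomial (Fin 3) K) ((D c).choose n)]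
  unfold shearExp
  rw [X_pow_eq_monomial, X_pow_eq_monomial, X_pow_eq_monomial, X_pow_eq_monomial, C_mul_monomial, C_mul_monomial,
    C_apply]
  simp only [monomial_mul, mul_one, add_zero]
  rw [monomial_eq_monomial_iff]
  left
  refine ⟨?_, by ring⟩
  ext w
  simp only [Finsupp.add_apply, Finsupp.single_apply]
  split_ifs <;> omega

omit [DecidableEq K] in
/-- **COEFFICIENTS OF THE SHEAR (PROVED).** [folklore] -/
theorem coeff_shear (hab : a ≠ b) (hac : a ≠ c) (hbc : b ≠ c) (g : K) (F : MvPolynomial (Fin 3) K) (E : Fin 3 →₀ ℕ) :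
    coeff E (shear c a g F) =
      ∑ D ∈ F.support, ∑ n ∈ Finset.range (D c + 1),
        if shearExp a b c D n = E then coeff D F * g ^ n * ((D c).choose n : K) else 0 := by
  classical
  conv_lhs => rw [F.as_sum, map_sum, coeff_sum]
  refine Finset.sum_congr rfl fun D _ => ?_
  rw [shear_monomial hab hac hbc, coeff_sum]
  refine Finset.sum_congr rfl fun n _ => ?_
  rw [coeff_monomial]

omit [DecidableEq K] in
/-- **EVERY MONOMIAL OF THE SHEARED EQUATION COMES FROM A MONOMIAL OF `F` BY CONVERTING `n ≤ D c` LETTERS `c` INTO `a`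
(PROVED).** [folklore] -/
theorem exists_shearExp_eq_of_mem_support_shear (hab : a ≠ b) (hac : a ≠ c) (hbc : b ≠ c) (g : K)
    (F : MvPolynomial (Fin 3) K) {E : Fin 3 →₀ ℕ} (hE : E ∈ (shear c a g F).support) :
    ∃ D ∈ F.support, ∃ n, n ≤ D c ∧ shearExp a b c D n = E := by
  classical
  rw [mem_support_iff, coeff_shear hab hac hbc] at hE
  obtain ⟨D, hD, hne⟩ := Finset.exists_ne_zero_of_sum_ne_zero hE
  obtain ⟨n, hn, hne'⟩ := Finset.exists_ne_zero_of_sum_ne_zero hne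
  refine ⟨D, hD, n, Nat.lt_succ_iff.mp (Finset.mem_range.mp hn), ?_⟩
  by_contra h
  exact hne' (if_neg h)

omit [DecidableEq K] in
/-- **AN EXPONENT NOT REACHABLE FROM ANOTHER MONOMIAL KEEPS ITS COEFFICIENT (PROVED):** if no monomial `u^D` of `F` with
`n ≥ 1` converted letters lands on `E`, then `coeff_E (σF) = coeff_E F`. [folklore; CJS2020 proof of Lemma 13.3] -/
theorem coeff_shear_eq_coeff (hab : a ≠ b) (hac : a ≠ c) (hbc : b ≠ c) (g : K) (F : MvPolynomial (Fin 3) K)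
    {E : Fin 3 →₀ ℕ} (hE : ∀ D ∈ F.support, ∀ n, 1 ≤ n → n ≤ D c → shearExp a b c D n ≠ E) :
    coeff E (shear c a g F) = coeff E F := by
  classical
  rw [coeff_shear hab hac hbc]
  have hinner : ∀ D ∈ F.support,
      (∑ n ∈ Finset.range (D c + 1), if shearExp a b c D n = E then coeff D F * g ^ n * ((D c).choose n : K) else 0) =
        if D = E then coeff D F else 0 := by
    intro D hD
    rw [Finset.sum_eq_single 0]
    · rw [shearExp_zero hab hac hbc, pow_zero, mul_one, Nat.choose_zero_right, Nat.cast_one, mul_one]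
    · intro n hn hn0
      rw [if_neg (hE D hD n (Nat.one_le_iff_ne_zero.mpr hn0) (Nat.lt_succ_iff.mp (Finset.mem_range.mp hn)))]
    · intro h; exact absurd (Finset.mem_range.mpr (Nat.succ_pos _)) h
  rw [Finset.sum_congr rfl hinner, Finset.sum_ite_eq' F.support E (fun D => coeff D F)]
  split_ifs with h
  · rfl
  · rw [mem_support_iff, not_not] at h; exact h.symm

/-! ## §2 THE V-LEMMA: the vertex is invariant under the shear of the free letter into a heavy wall -/

omit [DecidableEq K] in
/-- The abscissa of the point of a monomial grows strictly past `α` when letters `c` are converted into `a` (`n ≥ 1`), provided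
`α < 1`; and a monomial from the apex region (`D c ≥ s`) whose conversion lands below the ceiling lands at abscissa `≥ 1`.
Technical core of the V-lemma. [new] -/
theorem alphaOf_lt_fst_resPoint_shearExp (hab : a ≠ b) (hac : a ≠ c) (hbc : b ≠ c) {s : ℕ} {r : Fin 3 →₀ ℕ} (hrc : r c = 0)
    {F : MvPolynomial (Fin 3) K} (hα : alphaOf (polyPts s r a b c F) < 1) {D : Fin 3 →₀ ℕ} (hD : D ∈ F.support)
    (hraD : r a ≤ D a) {n : ℕ} (hn1 : 1 ≤ n) (hnD : n ≤ D c) (hEc : D c - n < s) :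
    alphaOf (polyPts s r a b c F) < (resPoint s r a b c (shearExp a b c D n)).1 := by
  classical
  have hfst : (resPoint s r a b c (shearExp a b c D n)).1 =
      ((((D a + n : ℕ) : ℚ)) - r a) / (((s : ℕ) : ℚ) + r c - ((D c - n : ℕ) : ℚ)) := by
    show ((((shearExp a b c D n a : ℕ) : ℚ)) - r a) / (((s : ℕ) : ℚ) + r c - (shearExp a b c D n c : ℕ)) = _
    rw [shearExp_apply_fst hab hac, shearExp_apply_thd hac hbc]
  rw [hfst, hrc, Nat.cast_sub hnD]
  push_cast
  have hden : (0 : ℚ) < (s : ℚ) + 0 - ((D c : ℚ) - n) := by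
    have h1 : ((D c : ℕ) : ℚ) - n < s := by
      have : ((D c - n : ℕ) : ℚ) < s := by exact_mod_cast hEc
      rw [Nat.cast_sub hnD] at this; exact this
    linarith
  rw [lt_div_iff₀ hden]
  have hn1' : (1 : ℚ) ≤ n := by exact_mod_cast hn1
  have hraD' : ((r a : ℕ) : ℚ) ≤ D a := by exact_mod_cast hraD
  by_cases hDc : D c < s
  · -- the source monomial has a point `P` of the polygon, `P.1 ≥ α`
    have hmem : resPoint s r a b c D ∈ polyPts s r a b c F :=
      Finset.mem_image_of_mem _ (Finset.mem_filter.mpr ⟨hD, by rw [hrc, add_zero]; exact hDc⟩)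
    have hP := alphaOf_le_fst hmem
    have hP1 : (resPoint s r a b c D).1 = (((D a : ℕ) : ℚ) - r a) / (((s : ℕ) : ℚ) + r c - D c) := rfl
    rw [hP1, hrc] at hP
    push_cast at hP
    have hY : (0 : ℚ) < (s : ℚ) + 0 - D c := by
      have : ((D c : ℕ) : ℚ) < s := by exact_mod_cast hDc
      linarith
    rw [le_div_iff₀ hY] at hP
    nlinarith
  · -- apex-region source: lands at abscissa ≥ 1 > α
    have hDc' : ((s : ℕ) : ℚ) ≤ D c := by exact_mod_cast (not_lt.mp hDc)
    nlinarith

omit [DecidableEq K] in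
/-- **THE V-LEMMA, uncleaned (PROVED):** under `α < 1`, `r c = 0` and `r a ≤ D a` on the support, the vertex of the point set of
`σ_{c,a,g} F` in the frame `(a, b ; c)` is the vertex of the point set of `F`. [CJS2020 Lemma 7.x / proof of Lemma 13.3, for the
tree's finite generating sets; new for the walk] -/
theorem vertexOf_polyPts_shear (hab : a ≠ b) (hac : a ≠ c) (hbc : b ≠ c) {s : ℕ} {r : Fin 3 →₀ ℕ} (hrc : r c = 0) (g : K)
    {F : MvPolynomial (Fin 3) K} (hra : ∀ D ∈ F.support, r a ≤ D a) (hne : (polyPts s r a b c F).Nonempty)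
    (hα : alphaOf (polyPts s r a b c F) < 1) :
    vertexOf (polyPts s r a b c (shear c a g F)) = vertexOf (polyPts s r a b c F) := by
  classical
  set v := vertexOf (polyPts s r a b c F) with hv
  obtain ⟨Dv, hDv, hDve⟩ := Finset.mem_image.mp (vertexOf_mem hne)
  obtain ⟨hDvF, hDvc⟩ := Finset.mem_filter.mp hDv
  -- (A) the vertex monomial keeps its coefficient
  have hreach : ∀ D ∈ F.support, ∀ n, 1 ≤ n → n ≤ D c → shearExp a b c D n ≠ Dv := by
    intro D hD n hn1 hnD hE
    have hEc : D c - n < s := by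
      have : shearExp a b c D n c < s := by rw [hE]; rw [hrc, add_zero] at hDvc; exact hDvc
      rwa [shearExp_apply_thd hac hbc] at this
    have hlt := alphaOf_lt_fst_resPoint_shearExp hab hac hbc hrc hα hD (hra D hD) hn1 hnD hEc
    rw [hE, hDve] at hlt
    exact lt_irrefl _ hlt
  have hcoeff : coeff Dv (shear c a g F) = coeff Dv F := coeff_shear_eq_coeff hab hac hbc g F hreach
  have hDvS : Dv ∈ (shear c a g F).support := by
    rw [mem_support_iff, hcoeff]; exact mem_support_iff.mp hDvF
  refine vertexOf_eq (Finset.mem_image.mpr ⟨Dv, Finset.mem_filter.mpr ⟨hDvS, hDvc⟩, hDve⟩) fun w hw => ?_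
  -- (B) every point of the sheared set is lexicographically above `v`
  obtain ⟨E, hE, rfl⟩ := Finset.mem_image.mp hw
  obtain ⟨hES, hEc⟩ := Finset.mem_filter.mp hE
  obtain ⟨D, hD, n, hnD, hDE⟩ := exists_shearExp_eq_of_mem_support_shear hab hac hbc g F hES
  rcases Nat.eq_zero_or_pos n with hn0 | hnpos
  · subst hn0
    rw [shearExp_zero hab hac hbc] at hDE
    subst hDE
    exact vertexOf_le (Finset.mem_image_of_mem _ (Finset.mem_filter.mpr ⟨hD, hEc⟩))
  · have hEc' : D c - n < s := by
      rw [← hDE, shearExp_apply_thd hac hbc, hrc, add_zero] at hEc; exact hEc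
    have hlt := alphaOf_lt_fst_resPoint_shearExp hab hac hbc hrc hα hD (hra D hD) hnpos hnD hEc'
    rw [hDE] at hlt
    rw [toLex_le_toLex_iff]
    exact Or.inl hlt

omit [DecidableEq K] in
/-- **THE V-LEMMA (PROVED):** the same after CLEANING — deleting the `q`-th power monomials of the sheared equation does not touch
the vertex, an original monomial of the CLEAN equation `F`. [new] -/
theorem vertexOf_polyPts_deletePthPowers_shear (hab : a ≠ b) (hac : a ≠ c) (hbc : b ≠ c) {s : ℕ} {r : Fin 3 →₀ ℕ}
    (hrc : r c = 0) (g : K) {F : MvPolynomial (Fin 3) K} (hra : ∀ D ∈ F.support, r a ≤ D a)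
    (hclean : ∀ D ∈ F.support, ¬ IsPthPowerExponent q D) (hne : (polyPts s r a b c F).Nonempty)
    (hα : alphaOf (polyPts s r a b c F) < 1) :
    vertexOf (polyPts s r a b c (deletePthPowers q (shear c a g F))) = vertexOf (polyPts s r a b c F) := by
  classical
  set v := vertexOf (polyPts s r a b c F) with hv
  obtain ⟨Dv, hDv, hDve⟩ := Finset.mem_image.mp (vertexOf_mem hne)
  obtain ⟨hDvF, hDvc⟩ := Finset.mem_filter.mp hDv
  have hreach : ∀ D ∈ F.support, ∀ n, 1 ≤ n → n ≤ D c → shearExp a b c D n ≠ Dv := by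
    intro D hD n hn1 hnD hE
    have hEc : D c - n < s := by
      have : shearExp a b c D n c < s := by rw [hE]; rw [hrc, add_zero] at hDvc; exact hDvc
      rwa [shearExp_apply_thd hac hbc] at this
    have hlt := alphaOf_lt_fst_resPoint_shearExp hab hac hbc hrc hα hD (hra D hD) hn1 hnD hEc
    rw [hE, hDve] at hlt
    exact lt_irrefl _ hlt
  have hcoeff : coeff Dv (shear c a g F) = coeff Dv F := coeff_shear_eq_coeff hab hac hbc g F hreach
  have hDvS : Dv ∈ (deletePthPowers q (shear c a g F)).support := by
    rw [support_deletePthPowers', Finset.mem_filter, mem_support_iff, hcoeff]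
    exact ⟨mem_support_iff.mp hDvF, hclean Dv hDvF⟩
  refine vertexOf_eq (Finset.mem_image.mpr ⟨Dv, Finset.mem_filter.mpr ⟨hDvS, hDvc⟩, hDve⟩) fun w hw => ?_
  obtain ⟨E, hE, rfl⟩ := Finset.mem_image.mp hw
  obtain ⟨hES, hEc⟩ := Finset.mem_filter.mp hE
  have hES' : E ∈ (shear c a g F).support := by
    rw [support_deletePthPowers', Finset.mem_filter] at hES; exact hES.1
  obtain ⟨D, hD, n, hnD, hDE⟩ := exists_shearExp_eq_of_mem_support_shear hab hac hbc g F hES'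
  rcases Nat.eq_zero_or_pos n with hn0 | hnpos
  · subst hn0
    rw [shearExp_zero hab hac hbc] at hDE
    subst hDE
    exact vertexOf_le (Finset.mem_image_of_mem _ (Finset.mem_filter.mpr ⟨hD, hEc⟩))
  · have hEc' : D c - n < s := by
      rw [← hDE, shearExp_apply_thd hac hbc, hrc, add_zero] at hEc; exact hEc
    have hlt := alphaOf_lt_fst_resPoint_shearExp hab hac hbc hrc hα hD (hra D hD) hnpos hnD hEc'
    rw [hDE] at hlt
    rw [toLex_le_toLex_iff]
    exact Or.inl hlt

omit [DecidableEq K] in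
/-- The prepared point set is non-empty when the original is (the vertex survives). [new] -/
theorem polyPts_deletePthPowers_shear_nonempty (hab : a ≠ b) (hac : a ≠ c) (hbc : b ≠ c) {s : ℕ} {r : Fin 3 →₀ ℕ}
    (hrc : r c = 0) (g : K) {F : MvPolynomial (Fin 3) K} (hra : ∀ D ∈ F.support, r a ≤ D a)
    (hclean : ∀ D ∈ F.support, ¬ IsPthPowerExponent q D) (hne : (polyPts s r a b c F).Nonempty)
    (hα : alphaOf (polyPts s r a b c F) < 1) :
    (polyPts s r a b c (deletePthPowers q (shear c a g F))).Nonempty := by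
  classical
  obtain ⟨Dv, hDv, hDve⟩ := Finset.mem_image.mp (vertexOf_mem hne)
  obtain ⟨hDvF, hDvc⟩ := Finset.mem_filter.mp hDv
  have hreach : ∀ D ∈ F.support, ∀ n, 1 ≤ n → n ≤ D c → shearExp a b c D n ≠ Dv := by
    intro D hD n hn1 hnD hE
    have hEc : D c - n < s := by
      have : shearExp a b c D n c < s := by rw [hE]; rw [hrc, add_zero] at hDvc; exact hDvc
      rwa [shearExp_apply_thd hac hbc] at this
    have hlt := alphaOf_lt_fst_resPoint_shearExp hab hac hbc hrc hα hD (hra D hD) hn1 hnD hEc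
    rw [hE, hDve] at hlt
    exact lt_irrefl _ hlt
  have hcoeff : coeff Dv (shear c a g F) = coeff Dv F := coeff_shear_eq_coeff hab hac hbc g F hreach
  have hDvS : Dv ∈ (deletePthPowers q (shear c a g F)).support := by
    rw [support_deletePthPowers', Finset.mem_filter, mem_support_iff, hcoeff]
    exact ⟨mem_support_iff.mp hDvF, hclean Dv hDvF⟩
  exact ⟨_, Finset.mem_image_of_mem _ (Finset.mem_filter.mpr ⟨hDvS, hDvc⟩)⟩

omit [DecidableEq K] in
/-- `alphaOf`/`betaOf` corollaries of the V-lemma. [new] -/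
theorem betaOf_polyPts_deletePthPowers_shear (hab : a ≠ b) (hac : a ≠ c) (hbc : b ≠ c) {s : ℕ} {r : Fin 3 →₀ ℕ}
    (hrc : r c = 0) (g : K) {F : MvPolynomial (Fin 3) K} (hra : ∀ D ∈ F.support, r a ≤ D a)
    (hclean : ∀ D ∈ F.support, ¬ IsPthPowerExponent q D) (hne : (polyPts s r a b c F).Nonempty)
    (hα : alphaOf (polyPts s r a b c F) < 1) :
    betaOf (polyPts s r a b c (deletePthPowers q (shear c a g F))) = betaOf (polyPts s r a b c F) ∧
      alphaOf (polyPts s r a b c (deletePthPowers q (shear c a g F))) = alphaOf (polyPts s r a b c F) := by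
  unfold betaOf alphaOf
  rw [vertexOf_polyPts_deletePthPowers_shear hab hac hbc hrc g hra hclean hne hα]
  exact ⟨rfl, rfl⟩

/-! ## §3 Walk level: `β` does not increase at a kept exit X1 translated along the free letter (law (L_X1)) -/

/-- **LAW (L_X1) (PROVED): `β_{t+1} ≤ β_t` at a move in the chart of the HEAVY wall `a` translated only along the free letter `c`.**
With the wall bookkeeping of `polyPts_succ_chart_fst_translated` and `q ≤ s + r_t a` (the loss wall is heavy — automatic on a lossy
tail, `LossEpisode.tail_sorts_heavy`): `β_{t+1} = γ⁻(Δ*) ≤ β(Δ*) = β_t`, `Δ*` = the point set of the sheared-and-cleaned equation.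
[CJS2020 Lemma 13.3 case (1:0) (`β' = γ⁻ ≤ β`) in prepared coordinates, for the walk; new] -/
theorem betaOf_polyPts_succ_chart_fst_translated_le (hs : IsRoot q s₀) (W : ForcedWalk q s₀) (t : ℕ) (hab : a ≠ b)
    (hac : a ≠ c) (hbc : b ≠ c) (hj : W.j t = a) (hb : ∀ w, w ≠ c → W.b t w = 0) {s : ℕ}
    (hrb : (W.st (t + 1)).r b = (W.st t).r b) (hra : (W.st (t + 1)).r a + q = s + (W.st t).r a + (W.st t).r b)
    (hrc : (W.st t).r c = 0) (hrc' : (W.st (t + 1)).r c = 0) (hq : q ≤ s + (W.st t).r a) :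
    betaOf (polyPts s (W.st (t + 1)).r a b c (W.st (t + 1)).F) ≤ betaOf (polyPts s (W.st t).r a b c (W.st t).F) := by
  classical
  have hraD : ∀ D ∈ (W.st t).F.support, (W.st t).r a ≤ D a := fun D hD => walk_r hs W t D hD a
  have hclean : ∀ D ∈ (W.st t).F.support, ¬ IsPthPowerExponent q D := fun D hD =>
    not_isPthPowerExponent_of_mem_support hs W t hD
  have hne : (polyPts s (W.st t).r a b c (W.st t).F).Nonempty := polyPts_nonempty_of_heavy_fst hs W t hac b hq hrc
  have hα : alphaOf (polyPts s (W.st t).r a b c (W.st t).F) < 1 := alphaOf_polyPts_lt_one hs W t hac b hq hrc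
  have hne' := polyPts_deletePthPowers_shear_nonempty hab hac hbc hrc (W.b t c) hraD hclean hne hα
  rw [polyPts_succ_chart_fst_translated hs W t hab hac hbc hj hb hrb hra hrc hrc', betaOf_image_psi10 hne',
    ← (betaOf_polyPts_deletePthPowers_shear hab hac hbc hrc (W.b t c) hraD hclean hne hα).1]
  exact gammaMinusOf_le_betaOf hne'

/-- … and `α_{t+1} = δ(Δ*) − 1` (the new abscissa), recorded for the bookkeeping of the next move. [CJS2020 Lemma 13.3; new] -/
theorem alphaOf_polyPts_succ_chart_fst_translated (hs : IsRoot q s₀) (W : ForcedWalk q s₀) (t : ℕ) (hab : a ≠ b)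
    (hac : a ≠ c) (hbc : b ≠ c) (hj : W.j t = a) (hb : ∀ w, w ≠ c → W.b t w = 0) {s : ℕ}
    (hrb : (W.st (t + 1)).r b = (W.st t).r b) (hra : (W.st (t + 1)).r a + q = s + (W.st t).r a + (W.st t).r b)
    (hrc : (W.st t).r c = 0) (hrc' : (W.st (t + 1)).r c = 0) (hq : q ≤ s + (W.st t).r a) :
    alphaOf (polyPts s (W.st (t + 1)).r a b c (W.st (t + 1)).F) =
      deltaOf (polyPts s (W.st t).r a b c (deletePthPowers q (shear c a (W.b t c) (W.st t).F))) - 1 := by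
  classical
  have hraD : ∀ D ∈ (W.st t).F.support, (W.st t).r a ≤ D a := fun D hD => walk_r hs W t D hD a
  have hclean : ∀ D ∈ (W.st t).F.support, ¬ IsPthPowerExponent q D := fun D hD =>
    not_isPthPowerExponent_of_mem_support hs W t hD
  have hne : (polyPts s (W.st t).r a b c (W.st t).F).Nonempty := polyPts_nonempty_of_heavy_fst hs W t hac b hq hrc
  have hα : alphaOf (polyPts s (W.st t).r a b c (W.st t).F) < 1 := alphaOf_polyPts_lt_one hs W t hac b hq hrc
  have hne' := polyPts_deletePthPowers_shear_nonempty hab hac hbc hrc (W.b t c) hraD hclean hne hα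
  unfold alphaOf
  rw [polyPts_succ_chart_fst_translated hs W t hab hac hbc hj hb hrb hra hrc hrc', vertexOf_image_psi10 hne']

end ShearVertex

end Summit.ResolutionOfSingularities.ResolutionOfSingularities.Theorems.LossPolygon
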